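/-
Copyright: lit-balaban cell, Phase-2 proof seat p11 (gen 7; v1.1 docstring correction gen 8).  Statement-level skeleton of a published
paper; no proof claims beyond what the kernel checks below.
-/
import Literature.MathematicalPhysics.QuantumFieldTheory.BalabanImbrieJaffe1984to88.BIJ85LineSumCentre

/-!
# `BalabanImbrieJaffe1984to88.BIJ85TreeGaugeCornerLines` — T. Bałaban, J. Imbrie, A. Jaffe, *Renormalization of the Higgs model: minimizers,
propagators and the stability of mean field theory*, Commun. Math. Phys. **97** (1985) 299–329 [BalabanImbrieJaffe1985]: Sect. 7.3
p. 326 — **THE CORNER-LINE VERSION, IN GEN 6's TYPES: THE LOCATED LINE-SUM CONSTANT `K_T` OF THE SECOND PRINTED FORM OF (7.3.2) ON EXACT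
FIELDS IS REDUCED TO THE CORNER DIFFERENCES OF PROP. 5.2.2's GAUGE FUNCTION `D`** (file 4 of the gen-7 member of SKELETON row
**C1.Eq7.3.1-7.3.2**; files 1–3 = `BIJ85TreeGaugeLineSums`, `BIJ85AxialLineSum`, `BIJ85LineSumCentre`).

statement-level skeleton of published theorems with citation tags; proofs where landed; nothing here is a claim about the Yang–Mills mass gap

PDF held: `paper:balaban1985-cmp97-bij-higgs-minimizers` (journal page = PDF page + 298).  Pages re-read this session (OCR text):
p. 302 [PDF 4] ((2.4)–(2.6): print's block convention, contours from the corner `y`), p. 312 [PDF 14] ((4.5.3)), p. 313–314 [PDF 15–16]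
((5.1.2)–(5.1.3)), p. 326 [PDF 28]; v1.1: p0004, p0014, p0028 re-read on the OCR layer (referee ref-1's gen-48 F4-nit ×2: v1 quoted (4.5.3)
in a contour-holonomy paraphrase with the locator p. 313, gave (2.4) in its k-block η-lattice form, and opened the p. 326 sentence with
«Alternatively,» — none of the three is print; corrected below, nothing else in the file changes).

CITATION HEADER (lean-in-tree rule).  Phase-2 file of the lit-balaban TYPED SKELETON (HOME `run/shared/lean/pub/lit-balaban/`), seat p11
gen 7 (unit `lit-balaban-p11-g7`; TAKING line HOME/STATUS.md 2026-08-21T22:35:54Z; owner r15, referee ref-5).  Objects BY NAME, nothing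
re-declared: gen 6's `BIJ85Ineq732SecondForm.lineSumIter` (the straight-line sums `Σ_{b′⊂b}` of (5.1.2) rooted at print's CORNERS, via r03's
`BIJ85BlockAveragesTorusK.cornerIter`/`corner`), `BIJ85LineSumExact.lvlR` (level transport `k ↔ 0 + k`), `eta_mul_lineSumIter_QsE`,
`lineSumIter_gradV1`; gen 6's located field `BIJ85Claim73SecondForm.SecClosedIdx.hT` is the TARGET SHAPE; file 1's tree-gauge/Stokes lemmas
(`abs_bondAvg_sub_centre_le`, `abs_segSum_sub_segSum_centre_le` — valid for EVERY base point of the block, in particular the corner),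
`abs_curl_bondAvgIter_le`, `tgConst`; file 2's `deltaAx_hax`/`bondAvgIter_hax`/`abs_curl_one_hax_le`; file 3's `TkF_dOne_eq_axial`; p33/p30/p19's
all-tori `K_R` (`BIJ85Claim73AllTori.exists_KR_allTori`).  Theorems only: no `def`, no named fact (D-0026).

THE PRINTED TEXT, verbatim.  p. 302 [PDF 4] l. 24–30: *"this definition extends naturally from an a-lattice to an La-lattice. We assume
this extension in dealing with powers of averaging operators, etc. Consider the example of a scalar field. Imbed the unit lattice in an
L-lattice of block B(y). Here y = Ln denotes a corner of a block, and n ∈ ℤ^d. Then B(y) consists of points x = (x₁, …, x_d) such that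
y_j ≦ x_j < y_j + L, j = 1, 2, …, d. (2.4)"* (the display line of (2.4) is partly lost on the OCR layer; its inequalities are read as in
the owner's row C1.Eq2.4) — print roots blocks and contours at the CORNER; READING (ours, NOT print; v1 had it inside quotation marks): by
the quoted extension sentence the k-fold blocks on the η-lattice are `B^k(y) = {x : y_μ ≦ x_μ < y_μ + L^kη}`.  p. 312 [PDF 14] l. 35–40:
*"the equivalent definition: (Q^{s*}_kv)_b = 1 if b is strictly contained in a k-block (both endpoints belong to the block); = v_c if the
η-lattice bond b belongs to the corridor of bonds connecting the two blocks B^k(c₋) and B^k(c₊). Here c is a unit lattice bond. (4.5.3)"*;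
READING (ours, NOT print; v1 quoted it as «(Q^{s*}_kv)(Γ_{b,b′}) = v_{b′}» with the locator p. 313): along a corner line of a unit bond `c`
exactly one fine bond lies in the corridor, so `η·Σ_{corner line of c}(Q^{s*}_kB) = B_c` (gen 6's `BIJ85LineSumExact.eta_mul_lineSumIter_QsE`, used in §5).  p. 326 [PDF 28]
l. 23–25: *"In axial gauge for the configuration v in a domain Λ′ ⊃ Λ we can substitute 𝒟_k∂^* = G_{k,Ax}∂^* + ∂D in the formula for u_k,
we use (5.3.1) to replace this by a minimizer in axial gauge."*

WHAT IS PROVED HERE (0 `sorry`, standard axioms; standing range `k ≤ m + K`, `2 ≤ d`).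
* §1 transports `lvlR` of gen 6 commute with `bondAvg`, `IsAxial`, the plaquette variable (kernel, `subst`).
* §2 **`abs_bondAvg_sub_corner_le`** — one level, print's corner as base point: for `A` axial on the (centred) blocks of `T^{(j+1)}` with
  `|A(∂p)| ≤ F`: `|(QA)(c) − L⁻¹·Σ_{corner line of c} A| ≤ 2·d⌊(L−1)/2⌋·F` (the tree-gauge condition controls EVERY site of the block, the corner
  included: file 1's two lemmas).
* §3 **`abs_lvlR_bondAvgIter_sub_lineSumIter_le`** — multilevel, along gen 6's corner lines: for `A ∈ δ_{k,Ax}` with `|A(∂p)| ≤ F` and every unit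
  bond `c` (at gen 6's level `0 + k`), `|(Q_kA)(c) − L^{−k}·lineSumIter A k c| ≤ 2·tgConst(k)·F ≤ d·L^k·F`.
* §4 **`abs_lvlR_sub_eta_lineSumIter_hax_le`** / **`exists_KHcorner_allTori`** — for `A = H_{k,Ax}B`: `|B_c − η·lineSumIter(H_{k,Ax}B) k c| ≤ d·K_R·s`
  (`|∂B| ≤ s`), one torus given `K_R`, and ONE constant `d·K_R` over all tori of a dimension and block size (hypothesis-free).
* §5 **`eta_lineSumIter_TkF_exact_axial`** (identity: `η·lineSumIter(T_k∂B) k c = B_c − η·lineSumIter(H_{k,Ax}B) k c − [D(J)(cornerIter_k c₊) −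
  D(J)(cornerIter_k c₋)]`, `J = Q^{e*}_k∂B`), **`eta_abs_lineSumIter_TkF_le_exact`** (`η·|lineSumIter(T_k∂B) k c| ≤ d·K_R·s + |ΔD|` — EXACTLY the
  left side of gen 6's `SecClosedIdx.hT` on exact fields) and **`exists_KT_reduction_allTori`** (all tori, one constant): gen 6's located
  line-sum constant on exact fields is REDUCED to the corner differences of Prop. 5.2.2's gauge function `D(Q^{e*}_k∂B)` ALONE — the `K_H` and
  `λ_k` pieces of gen 6's reduction (`BIJ85LineSumExact.lineSum_bound_of_pieces`) are DISCHARGED by the axial route with constant `d·K_R`.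
HONEST SCOPE.  (i) The corner difference `D(J)(cornerIter_k c₊) − D(J)(cornerIter_k c₋)` is NOT bounded here (nor is the centre difference
of file 3): it is the located remainder of the row's second printed form (GAPS G-C1-05 ADDENDUM 6).  (ii) Exact fields `g = ∂B` only (the
harmonic classes of `T^{(k)}` are not exact).  (iii) `U = 1` real abelian fields; torus; constants explicit, not optimised.  Nothing here
is summit progress.
-/

open scoped BigOperators RealInnerProductSpace
open Finset

namespace Literature.MathematicalPhysics.QuantumFieldTheory.BalabanImbrieJaffe1984to88.BIJ85TreeGaugeCornerLines

open Literature.MathematicalPhysics.QuantumFieldTheory.Balaban1983to89 hiding Site Plaq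
open Balaban1983to89.LatticeFieldCalculus
open BIJ85BlockAveragesTorus (corner)
open BIJ85BlockAveragesTorusK (cornerIter)
open BIJ85Ineq732SecondForm (lineSumU lineSumIter lineSumIter_zero lineSumIter_succ lineSumIter_neg)
open BIJ85Claim73SecondForm (lineSumIter_add)
open BIJ85LineSumExact (lvlR eta_mul_lineSumIter_QsE lineSumIter_gradV1)
open BIJ85AxialPropagator411 (BondSpace PlaqSpace curlOp toE deltaAx deltaAx_succ)
open BIJ85Prop521Torus (CoarseSpace toEj QsE)
open BIJ85Prop522Torus (DkE HkE HaxE D527E)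
open BIJ85LandauMinimizer442V1 (gradV1)
open BIJ85Sigma421Torus (toU QesOp)
open BIJ85Sigma422Eta (eta_pos eta_inv)
open BIJ85Eq611Torus (dOne)
open BIJ85Eq454PlaqResidual (resE eta_mul_L_pow)
open BIJ85UnitTorusHodge (IsClosedPlaq)
open BIJ85Claim73AllTori (exists_KR_allTori)
open BIJ88Eq541Base0 (TkF)
open BIJ85TreeGaugeLineSums (abs_bondAvg_sub_centre_le abs_segSum_sub_segSum_centre_le abs_curl_bondAvgIter_le tgConst tgConst_succ
  tgConst_le tgConst_nonneg)
open BIJ85AxialLineSum (deltaAx_hax bondAvgIter_hax abs_curl_one_hax_le)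
open BIJ85LineSumCentre (TkF_dOne_eq_axial)
open Balaban1983to89 renaming Site → TSite, Plaq → TPlaq

noncomputable section

variable {P : Params}

/-! ## §1  Level transports -/

/-- kernel: gen 6's transport commutes with the block average `Q`. [cite: BalabanImbrieJaffe1985, (2.13) p.304] -/
theorem lvlR_bondAvg {n n' : ℕ} (h : n = n') (h1 : n + 1 = n' + 1) (A : VecField P n ℝ) : lvlR h1 (bondAvg A) = bondAvg (lvlR h A) := by
  subst h; rfl

/-- kernel: gen 6's transport preserves the axial gauge condition. [cite: Balaban1984PropagatorsI, (1.10) p.19] -/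
theorem isAxial_lvlR {n n' : ℕ} (h : n = n') {A : VecField P n ℝ} (hA : IsAxial A) : IsAxial (lvlR h A) := by
  subst h; exact hA

/-- kernel: gen 6's transport preserves bounds on the plaquette variable. [cite: Balaban1984PropagatorsI, (1.2) p.18] -/
theorem abs_curl_lvlR_le {n n' : ℕ} (h : n = n') {A : VecField P n ℝ} {F : ℝ} (hF : ∀ p, |curl 1 A p| ≤ F) :
    ∀ p, |curl 1 (lvlR h A) p| ≤ F := by
  subst h; exact hF

/-- kernel: gen 6's transport is the identity pointwise on function equalities. [cite: BalabanImbrieJaffe1985, (2.1) p.302] -/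
theorem lvlR_congr {n n' : ℕ} (h : n = n') {A A' : PBond P n → ℝ} (hAA' : A = A') : lvlR h A = lvlR h A' := by rw [hAA']

/-! ## §2  One level, the corner as base point -/

/-- **ONE LEVEL AT THE CORNER**: for `A` axial on the (centred) blocks of `T^{(j+1)}` (r18's `IsAxial`) with `|A(∂p)| ≤ F` and every bond `c`
of `T^{(j+1)}`: `|(QA)(c) − L⁻¹·Σ_{t<L} A(corner(c₋) + te_μ, ·)| ≤ 2·d⌊(L−1)/2⌋·F` — file 1's centre lemma plus its ribbon lemma between the
corner run and the centre run (the corner is the block site of offset `0`; standing range). [cite: BalabanImbrieJaffe1985, (7.3.2) p.326] -/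
theorem abs_bondAvg_sub_corner_le {j : ℕ} (hj : j + 1 ≤ P.m + P.K) {A : VecField P j ℝ} (hAx : IsAxial A) {F : ℝ} (hF0 : 0 ≤ F)
    (hF : ∀ p, |curl 1 A p| ≤ F) (c : PBond P (j + 1)) :
    |bondAvg A c - (P.L : ℝ)⁻¹ * segSum A (corner c.src) c.dir P.L| ≤ 2 * ((P.d * ((P.L - 1) / 2) : ℕ) : ℝ) * F := by
  have hL : (0 : ℝ) < P.L := Nat.cast_pos.mpr P.L_pos
  set C : ℝ := ((P.d * ((P.L - 1) / 2) : ℕ) : ℝ) with hC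
  have e1 := abs_bondAvg_sub_centre_le hj hAx hF0 hF c
  have e2 : |(P.L : ℝ)⁻¹ * segSum A (emb c.src) c.dir P.L - (P.L : ℝ)⁻¹ * segSum A (corner c.src) c.dir P.L| ≤ C * F := by
    rw [← mul_sub, abs_mul, abs_inv, abs_of_pos hL, abs_sub_comm]
    calc (P.L : ℝ)⁻¹ * |segSum A (corner c.src) c.dir P.L - segSum A (emb c.src) c.dir P.L| ≤ (P.L : ℝ)⁻¹ * (C * (P.L * F)) :=
          mul_le_mul_of_nonneg_left (abs_segSum_sub_segSum_centre_le hj hAx hF0 hF c.src (fun _ => ⟨0, P.L_pos⟩) c.dir) (by positivity)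
      _ = C * F := by field_simp
  calc |bondAvg A c - (P.L : ℝ)⁻¹ * segSum A (corner c.src) c.dir P.L|
      = |(bondAvg A c - (P.L : ℝ)⁻¹ * segSum A (emb c.src) c.dir P.L)
          + ((P.L : ℝ)⁻¹ * segSum A (emb c.src) c.dir P.L - (P.L : ℝ)⁻¹ * segSum A (corner c.src) c.dir P.L)| := by ring_nf
    _ ≤ C * F + C * F := (abs_add_le _ _).trans (add_le_add e1 e2)
    _ = 2 * C * F := by ring

/-! ## §3  The multilevel statement along gen 6's corner lines -/

/-- **CORNER-LINE SUMS OF A FIELD IN THE ITERATED AXIAL GAUGE ARE ITS BLOCK AVERAGES, UP TO A FLUX**: for every fine bond field `A` with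
`δ_{k,Ax}(A)` and `|A(∂p)| ≤ F`, and every unit bond `c` (gen 6's level `0 + k`; standing range `k ≤ m + K`):
`|(Q_kA)(c) − L^{−k}·lineSumIter A k c| ≤ 2·tgConst(k)·F` — level by level as file 1's centre-line theorem, each level at the corner (§2);
gen 6's `lineSumIter` recursion is the composite structure (5.1.2)–(5.1.3) of print's corner lines. [cite: BalabanImbrieJaffe1985, (7.3.2) p.326] -/
theorem abs_lvlR_bondAvgIter_sub_lineSumIter_le : ∀ (k : ℕ), k ≤ P.m + P.K → ∀ (A : VecField P 0 ℝ), deltaAx k A → ∀ {F : ℝ}, 0 ≤ F →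
    (∀ p, |curl 1 A p| ≤ F) → ∀ c : PBond P (0 + k),
      |lvlR (Nat.zero_add k).symm (bondAvgIter k A) c - ((P.L : ℝ) ^ k)⁻¹ * lineSumIter A k c| ≤ 2 * tgConst P k * F
  | 0, _, A, _, F, _, _, c => by
    have h0 : lvlR (Nat.zero_add 0).symm (bondAvgIter 0 A) c = A c := rfl
    rw [h0, lineSumIter_zero]
    simp [tgConst]
  | k + 1, hk, A, hAx, F, hF0, hF, c => by
    have hL : (0 : ℝ) < P.L := Nat.cast_pos.mpr P.L_pos
    have hLne : (P.L : ℝ) ≠ 0 := hL.ne'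
    obtain ⟨hAxk, hax⟩ := (deltaAx_succ k A).1 hAx
    set A' : VecField P (0 + k) ℝ := lvlR (Nat.zero_add k).symm (bondAvgIter k A) with hA'
    set C : ℝ := ((P.d * ((P.L - 1) / 2) : ℕ) : ℝ) with hC
    have hk' : 0 + k + 1 ≤ P.m + P.K := by omega
    have hax' : IsAxial A' := isAxial_lvlR _ hax
    have hF' : ∀ p', |curl 1 A' p'| ≤ (P.L : ℝ) ^ k * F := abs_curl_lvlR_le _ (abs_curl_bondAvgIter_le k (by omega) A hF0 hF)
    have hF'0 : 0 ≤ (P.L : ℝ) ^ k * F := by positivity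
    -- the level-(k+1) average is the block average of the transported level-k field
    have hQ : lvlR (Nat.zero_add (k + 1)).symm (bondAvgIter (k + 1) A) = bondAvg A' := by
      rw [B5Eq120IterProof.bondAvgIter_succ]
      exact lvlR_bondAvg _ _ _
    -- step 1: one level at the corner
    have e1 : |bondAvg A' c - (P.L : ℝ)⁻¹ * segSum A' (corner c.src) c.dir P.L| ≤ 2 * C * ((P.L : ℝ) ^ k * F) :=
      abs_bondAvg_sub_corner_le hk' hax' hF'0 hF' c
    -- step 2: the `L` bonds on the corner run, each by the induction hypothesis
    have ih : ∀ t, |A' (runBond (corner c.src) c.dir t) - ((P.L : ℝ) ^ k)⁻¹ * lineSumIter A k (runBond (corner c.src) c.dir t)|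
        ≤ 2 * tgConst P k * F :=
      fun t => abs_lvlR_bondAvgIter_sub_lineSumIter_le k (by omega) A hAxk hF0 hF _
    have eq2 : (P.L : ℝ)⁻¹ * segSum A' (corner c.src) c.dir P.L - ((P.L : ℝ) ^ (k + 1))⁻¹ * lineSumIter A (k + 1) c
        = (P.L : ℝ)⁻¹ * ∑ t ∈ range P.L,
            (A' (runBond (corner c.src) c.dir t) - ((P.L : ℝ) ^ k)⁻¹ * lineSumIter A k (runBond (corner c.src) c.dir t)) := by
      rw [lineSumIter_succ, show lineSumU (lineSumIter A k) c = ∑ t ∈ range P.L, lineSumIter A k (runBond (corner c.src) c.dir t) from rfl,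
        segSum, sum_sub_distrib, mul_sub, mul_sum, mul_sum, mul_sum]
      congr 1
      refine sum_congr rfl fun t _ => ?_
      rw [pow_succ, mul_inv]
      ring
    have e2 : |(P.L : ℝ)⁻¹ * segSum A' (corner c.src) c.dir P.L - ((P.L : ℝ) ^ (k + 1))⁻¹ * lineSumIter A (k + 1) c|
        ≤ 2 * tgConst P k * F := by
      rw [eq2, abs_mul, abs_inv, abs_of_pos hL]
      calc (P.L : ℝ)⁻¹ * |∑ t ∈ range P.L,
              (A' (runBond (corner c.src) c.dir t) - ((P.L : ℝ) ^ k)⁻¹ * lineSumIter A k (runBond (corner c.src) c.dir t))|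
          ≤ (P.L : ℝ)⁻¹ * ∑ t ∈ range P.L, 2 * tgConst P k * F :=
            mul_le_mul_of_nonneg_left ((abs_sum_le_sum_abs _ _).trans (sum_le_sum fun t _ => ih t)) (by positivity)
        _ = 2 * tgConst P k * F := by rw [sum_const, card_range, nsmul_eq_mul]; field_simp
    have split : bondAvg A' c - ((P.L : ℝ) ^ (k + 1))⁻¹ * lineSumIter A (k + 1) c
        = (bondAvg A' c - (P.L : ℝ)⁻¹ * segSum A' (corner c.src) c.dir P.L)
          + ((P.L : ℝ)⁻¹ * segSum A' (corner c.src) c.dir P.L - ((P.L : ℝ) ^ (k + 1))⁻¹ * lineSumIter A (k + 1) c) := by ring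
    rw [hQ, split, tgConst_succ]
    calc _ ≤ 2 * C * ((P.L : ℝ) ^ k * F) + 2 * tgConst P k * F := (abs_add_le _ _).trans (add_le_add e1 e2)
      _ = _ := by rw [hC]; ring

/-- The same with the simplified constant `d·L^k·F`. [cite: BalabanImbrieJaffe1985, (7.3.2) p.326] -/
theorem abs_lvlR_bondAvgIter_sub_lineSumIter_le' {k : ℕ} (hk : k ≤ P.m + P.K) {A : VecField P 0 ℝ} (hAx : deltaAx k A) {F : ℝ}
    (hF0 : 0 ≤ F) (hF : ∀ p, |curl 1 A p| ≤ F) (c : PBond P (0 + k)) :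
    |lvlR (Nat.zero_add k).symm (bondAvgIter k A) c - ((P.L : ℝ) ^ k)⁻¹ * lineSumIter A k c| ≤ (P.d : ℝ) * (P.L : ℝ) ^ k * F := by
  refine (abs_lvlR_bondAvgIter_sub_lineSumIter_le k hk A hAx hF0 hF c).trans ?_
  have h := tgConst_le P k
  nlinarith [tgConst_nonneg P k, pow_nonneg (Nat.cast_nonneg P.L : (0 : ℝ) ≤ P.L) k]

/-! ## §4  `A = H_{k,Ax}B` along the corner lines -/

/-- **`|B_c − η·lineSumIter(H_{k,Ax}B) k c| ≤ d·K_R·s`** — one torus `P`, one scale `k ≤ m + K`, GIVEN the residual bound with constant `K_R` on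
`P` at scale `k` (`2 ≤ d`): for every unit-lattice bond field `B` with `|(∂B)(q)| ≤ s` and every unit bond `c` (gen 6's level `0 + k`), the
corner-line sum of the axial minimizer reproduces the datum — §3 at `F = η·K_R·s` (file 2's `abs_curl_one_hax_le`), (4.1.5), `η·L^k = 1`.
[cite: BalabanImbrieJaffe1985, (7.3.2) p.326] -/
theorem abs_lvlR_sub_eta_lineSumIter_hax_le (hd : 2 ≤ P.d) {k : ℕ} (hk : k ≤ P.m + P.K) {KR : ℝ}
    (hR : ∀ (f : TPlaq P k → ℝ), IsClosedPlaq f → ∀ (s : ℝ), 0 ≤ s → (∀ q, |f q| ≤ s) →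
      ∀ p : TPlaq P 0, |resE hd ((P.eta k) ^ P.d) (P.eta k)⁻¹ k (toU P k f) p| ≤ KR * Real.sqrt ((P.eta k) ^ P.d) * s)
    (hKR : 0 ≤ KR) (B : CoarseSpace P k) {s : ℝ} (hs0 : 0 ≤ s) (hs : ∀ q, |curl 1 (WithLp.ofLp B) q| ≤ s) (c : PBond P (0 + k)) :
    |lvlR (Nat.zero_add k).symm (WithLp.ofLp B) c
        - P.eta k * lineSumIter (WithLp.ofLp (HaxE P ((P.eta k) ^ P.d) (P.eta k)⁻¹ k B)) k c| ≤ (P.d : ℝ) * KR * s := by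
  have hη : 0 < P.eta k := eta_pos P k
  have hF0 : 0 ≤ P.eta k * KR * s := by positivity
  have hQ : bondAvgIter k (WithLp.ofLp (HaxE P ((P.eta k) ^ P.d) (P.eta k)⁻¹ k B)) = WithLp.ofLp B := by
    funext b; exact bondAvgIter_hax hk B b
  have h := abs_lvlR_bondAvgIter_sub_lineSumIter_le' hk (deltaAx_hax hk B) hF0 (abs_curl_one_hax_le hd hk hR B hs0 hs) c
  rw [lvlR_congr _ hQ, ← eta_inv, inv_inv] at h
  calc _ ≤ (P.d : ℝ) * (P.eta k)⁻¹ * (P.eta k * KR * s) := h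
    _ = (P.d : ℝ) * KR * s := by field_simp

/-- **ONE CONSTANT FOR ALL TORI, HYPOTHESIS-FREE** (corner lines): for every `d ≥ 2` and block size `L` there is `K ≥ 0` (`= d·K_R` with the
all-tori residual constant) such that for EVERY torus `P` with `P.d = d`, `P.L = L`, every `1 ≤ k ≤ m + K`, every `B` with `|∂B| ≤ s` and every
unit bond `c`: `|B_c − η·lineSumIter(H_{k,Ax}B) k c| ≤ K·s`. [cite: BalabanImbrieJaffe1985, (7.3.2) p.326] -/
theorem exists_KHcorner_allTori {d L : ℕ} (hd : 2 ≤ d) :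
    ∃ K : ℝ, 0 ≤ K ∧ ∀ (P : Params) (hPd : P.d = d), P.L = L → ∀ (k : ℕ), 1 ≤ k → k ≤ P.m + P.K →
      ∀ (B : CoarseSpace P k) (s : ℝ), 0 ≤ s → (∀ q, |curl 1 (WithLp.ofLp B) q| ≤ s) → ∀ c : PBond P (0 + k),
        |lvlR (Nat.zero_add k).symm (WithLp.ofLp B) c
            - P.eta k * lineSumIter (WithLp.ofLp (HaxE P ((P.eta k) ^ P.d) (P.eta k)⁻¹ k B)) k c| ≤ K * s := by
  obtain ⟨KR, hKR1, hKR⟩ := exists_KR_allTori (L := L) hd (a := 1) one_pos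
  refine ⟨(d : ℝ) * KR, by positivity, fun P hPd hPL k hk1 hk B s hs0 hs c => ?_⟩
  have h := abs_lvlR_sub_eta_lineSumIter_hax_le (hd.trans_eq hPd.symm) hk (hKR P hPd hPL k hk1 hk) (by linarith) B hs0 hs c
  have hcast : (P.d : ℝ) = d := by exact_mod_cast hPd
  rw [hcast] at h
  exact h

/-! ## §5  Gen 6's located line-sum constant on exact fields, reduced to the corner differences of `D` -/

/-- **THE CORNER-LINE DEFECT ON EXACT FIELDS, AS AN IDENTITY** (gen 6's types): for every unit-lattice bond field `B` and unit bond `c`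
(`k ≤ m + K`, `2 ≤ d`; weights of record; `J = Q^{e*}_k∂B`):
`η·lineSumIter(T_k∂B) k c = B_c − η·lineSumIter(H_{k,Ax}B) k c − [D(J)(cornerIter_k c₊) − D(J)(cornerIter_k c₋)]` — file 3's axial form of `T_k∂B`
with gen 6's `eta_mul_lineSumIter_QsE` ((4.5.3) along the corner line) and `lineSumIter_gradV1` (telescoping through the corners).
[cite: BalabanImbrieJaffe1985, (7.3.2) p.326] -/
theorem eta_lineSumIter_TkF_exact_axial (hd : 2 ≤ P.d) {k : ℕ} (hk : k ≤ P.m + P.K) (B : CoarseSpace P k) (c : PBond P (0 + k)) :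
    P.eta k * lineSumIter (TkF P hd ((P.eta k) ^ P.d) (P.eta k) k (fun p => dOne P k (P.eta k)⁻¹ B p)) k c =
      lvlR (Nat.zero_add k).symm (WithLp.ofLp B) c
        - P.eta k * lineSumIter (WithLp.ofLp (HaxE P ((P.eta k) ^ P.d) (P.eta k)⁻¹ k B)) k c
        - (D527E P ((P.eta k) ^ P.d) (P.eta k)⁻¹ k (QesOp (P := P) hd ((P.eta k) ^ P.d) k (dOne P k (P.eta k)⁻¹ B)) (cornerIter k c.tgt)
          - D527E P ((P.eta k) ^ P.d) (P.eta k)⁻¹ k (QesOp (P := P) hd ((P.eta k) ^ P.d) k (dOne P k (P.eta k)⁻¹ B)) (cornerIter k c.src)) := by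
  have hw : 0 < (P.eta k) ^ P.d := pow_pos (eta_pos P k) _
  have hη : P.eta k ≠ 0 := (eta_pos P k).ne'
  set Γ := D527E P ((P.eta k) ^ P.d) (P.eta k)⁻¹ k (QesOp (P := P) hd ((P.eta k) ^ P.d) k (dOne P k (P.eta k)⁻¹ B)) with hΓ
  have hT : (TkF P hd ((P.eta k) ^ P.d) (P.eta k) k (fun p => dOne P k (P.eta k)⁻¹ B p) : PBond P 0 → ℝ)
      = fun b' => (QsE P k B b' + -(WithLp.ofLp (HaxE P ((P.eta k) ^ P.d) (P.eta k)⁻¹ k B) b')) + -(gradV1 P (P.eta k)⁻¹ Γ b') := by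
    funext b'
    rw [TkF_dOne_eq_axial hd hk hw hη B b']
    show _ = (QsE P k B b' + -(HaxE P ((P.eta k) ^ P.d) (P.eta k)⁻¹ k B b')) + -(gradV1 P (P.eta k)⁻¹ Γ b')
    ring
  have e3 : lineSumIter (fun b' => (QsE P k B b' + -(WithLp.ofLp (HaxE P ((P.eta k) ^ P.d) (P.eta k)⁻¹ k B) b'))
        + -(gradV1 P (P.eta k)⁻¹ Γ b')) k c
      = lineSumIter (fun b' : PBond P 0 => QsE P k B b') k c
        - lineSumIter (WithLp.ofLp (HaxE P ((P.eta k) ^ P.d) (P.eta k)⁻¹ k B)) k c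
        - lineSumIter (fun b' : PBond P 0 => gradV1 P (P.eta k)⁻¹ Γ b') k c := by
    rw [lineSumIter_add, lineSumIter_add, lineSumIter_neg (fun b' => WithLp.ofLp (HaxE P ((P.eta k) ^ P.d) (P.eta k)⁻¹ k B) b'),
      lineSumIter_neg (fun b' => gradV1 P (P.eta k)⁻¹ Γ b')]
    dsimp only
    ring
  rw [hT, e3, lineSumIter_gradV1 hk, mul_sub, mul_sub, eta_mul_lineSumIter_QsE hk B c, ← mul_assoc (P.eta k) (P.eta k)⁻¹,
    mul_inv_cancel₀ hη, one_mul]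

/-- **GEN 6's LOCATED FIELD ON EXACT FIELDS, REDUCED**: one torus, given the residual constant `K_R` at scale `k ≤ m + K` (`2 ≤ d`): for every
`B` with `|(∂B)(q)| ≤ s` and every unit bond `c`,
`η·|lineSumIter(T_k∂B) k c| ≤ d·K_R·s + |D(J)(cornerIter_k c₊) − D(J)(cornerIter_k c₋)|` — exactly the left side of `SecClosedIdx.hT` at `g = ∂B`;
the `K_H` and `λ_k` pieces of gen 6's `lineSum_bound_of_pieces` are discharged, the corner difference of `D` remains.
[cite: BalabanImbrieJaffe1985, (7.3.2) p.326] -/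
theorem eta_abs_lineSumIter_TkF_le_exact (hd : 2 ≤ P.d) {k : ℕ} (hk : k ≤ P.m + P.K) {KR : ℝ}
    (hR : ∀ (f : TPlaq P k → ℝ), IsClosedPlaq f → ∀ (s : ℝ), 0 ≤ s → (∀ q, |f q| ≤ s) →
      ∀ p : TPlaq P 0, |resE hd ((P.eta k) ^ P.d) (P.eta k)⁻¹ k (toU P k f) p| ≤ KR * Real.sqrt ((P.eta k) ^ P.d) * s)
    (hKR : 0 ≤ KR) (B : CoarseSpace P k) {s : ℝ} (hs0 : 0 ≤ s) (hs : ∀ q, |curl 1 (WithLp.ofLp B) q| ≤ s) (c : PBond P (0 + k)) :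
    P.eta k * |lineSumIter (TkF P hd ((P.eta k) ^ P.d) (P.eta k) k (fun p => dOne P k (P.eta k)⁻¹ B p)) k c|
      ≤ (P.d : ℝ) * KR * s
        + |D527E P ((P.eta k) ^ P.d) (P.eta k)⁻¹ k (QesOp (P := P) hd ((P.eta k) ^ P.d) k (dOne P k (P.eta k)⁻¹ B)) (cornerIter k c.tgt)
          - D527E P ((P.eta k) ^ P.d) (P.eta k)⁻¹ k (QesOp (P := P) hd ((P.eta k) ^ P.d) k (dOne P k (P.eta k)⁻¹ B)) (cornerIter k c.src)| := by
  have hη : 0 < P.eta k := eta_pos P k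
  rw [show P.eta k * |lineSumIter (TkF P hd ((P.eta k) ^ P.d) (P.eta k) k (fun p => dOne P k (P.eta k)⁻¹ B p)) k c|
      = |P.eta k * lineSumIter (TkF P hd ((P.eta k) ^ P.d) (P.eta k) k (fun p => dOne P k (P.eta k)⁻¹ B p)) k c| by
    rw [abs_mul, abs_of_pos hη], eta_lineSumIter_TkF_exact_axial hd hk B c]
  have h1 := abs_lvlR_sub_eta_lineSumIter_hax_le hd hk hR hKR B hs0 hs c
  exact (abs_sub _ _).trans (add_le_add_left h1 _)

/-- **ONE CONSTANT FOR ALL TORI, HYPOTHESIS-FREE**: for every `d ≥ 2` and block size `L` there is `K ≥ 0` such that for EVERY torus `P` with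
`P.d = d`, `P.L = L`, every `1 ≤ k ≤ m + K`, every `B` with `|∂B| ≤ s` and every unit bond `c`:
`η·|lineSumIter(T_k∂B) k c| ≤ K·s + |D(J)(cornerIter_k c₊) − D(J)(cornerIter_k c₋)|` — gen 6's located line-sum constant `K_T` on exact fields
would follow, uniformly in the volume and the scale, from a uniform bound on the corner differences of Prop. 5.2.2's `D(Q^{e*}_k∂B)`.
[cite: BalabanImbrieJaffe1985, (7.3.2) p.326] -/
theorem exists_KT_reduction_allTori {d L : ℕ} (hd : 2 ≤ d) :
    ∃ K : ℝ, 0 ≤ K ∧ ∀ (P : Params) (hPd : P.d = d), P.L = L → ∀ (k : ℕ), 1 ≤ k → (hk : k ≤ P.m + P.K) →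
      ∀ (B : CoarseSpace P k) (s : ℝ), 0 ≤ s → (∀ q, |curl 1 (WithLp.ofLp B) q| ≤ s) → ∀ c : PBond P (0 + k),
        P.eta k * |lineSumIter (TkF P (hd.trans_eq hPd.symm) ((P.eta k) ^ P.d) (P.eta k) k (fun p => dOne P k (P.eta k)⁻¹ B p)) k c|
          ≤ K * s
            + |D527E P ((P.eta k) ^ P.d) (P.eta k)⁻¹ k
                  (QesOp (P := P) (hd.trans_eq hPd.symm) ((P.eta k) ^ P.d) k (dOne P k (P.eta k)⁻¹ B)) (cornerIter k c.tgt)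
              - D527E P ((P.eta k) ^ P.d) (P.eta k)⁻¹ k
                  (QesOp (P := P) (hd.trans_eq hPd.symm) ((P.eta k) ^ P.d) k (dOne P k (P.eta k)⁻¹ B)) (cornerIter k c.src)| := by
  obtain ⟨KR, hKR1, hKR⟩ := exists_KR_allTori (L := L) hd (a := 1) one_pos
  refine ⟨(d : ℝ) * KR, by positivity, fun P hPd hPL k hk1 hk B s hs0 hs c => ?_⟩
  have h := eta_abs_lineSumIter_TkF_le_exact (hd.trans_eq hPd.symm) hk (hKR P hPd hPL k hk1 hk) (by linarith) B hs0 hs c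
  have hcast : (P.d : ℝ) = d := by exact_mod_cast hPd
  rw [hcast] at h
  exact h

end

end Literature.MathematicalPhysics.QuantumFieldTheory.BalabanImbrieJaffe1984to88.BIJ85TreeGaugeCornerLines
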